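import Summits.ValiantsHypothesis.ValiantsHypothesis.Theorems.KPlusLogSqLawTridiagonalRealStaticUnitRecessiveCountAll

/-!
# Route «KPlusLogSqLaw», crux `WeakLifting` (stmt-ValiantsHypothesis-19561) — REAL side of the tridiagonal sector:
# the UNIT-COEFFICIENT sub-sector — the MIRROR of the recessive count law: exactly `⌊m/3⌋` zeros ABOVE the resonance for negative slopes (`m ≤ 8`)

HONEST FRAMING.  Helper theorems (`--supports stmt-ValiantsHypothesis-19561 --as helper`), seat val-sym-lift-p1 (g18), cell `pub-symmetroid`,
2026-08-28; companion of `…UnitRecessiveCount` / `…UnitRecessiveCountAll`.  Continuants `D_k = pathDet (fun _ => 1) d (fun _ => 1) f k`.  Proved here: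
* `eval_reflect` — the REFLECTION IDENTITY: for the reflected design `d′ = c − d`, `f′ = c − f` (`c` above all exponents below the size) one has
  `y^{kc}·D_k(1/y) = D′_k(y)` (all `k`, `y ≠ 0`); the reflection flips every edge slope, so the recessive side `(1, ∞)` of a negative-slope design
  is the recessive unit interval of its reflection;
* **THE DOMINANT-MIRROR COUNT LAW** (`card_posRoots_above_one_eq_div_three`): for `3 ≤ m ≤ 8`, all edge slopes NEGATIVE (`2f_k < d_k + d_{k+1}`) and
  every zero of `D_m` in `(1, ∞)` non-degenerate, the DISTINCT zeros of `D_m` in `(1, ∞)` number EXACTLY `⌊m/3⌋` — all exponents (bijection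
  `t ↦ 1/t` with the zeros of the reflected design in `(0,1)`, counted by `card_posRoots_unit_interval_eq_div_three`).
Together with the recessive law: every ONE-SIGNED unit design of size `m ≤ 8` has exactly `⌊m/3⌋` (distinct, simple) zeros on its recessive side, for
all exponents.  Nothing here is an upper law for the register (α NO MOVER); nothing bears on `WeakLifting` / `TropicalB` (stmt-19771) in their windows,
Conjecture B, the Door-A registers, `MatrixDescartes` (stmt-18050) or VP ≠ VNP.
[this seat; folklore: reciprocal substitution `x ↦ 1/x` for reflected exponents]
-/

-- `Summit.ValiantsHypothesis.ValiantsHypothesis.…` repeats a component by the D-0017 layout (single-conjunct summit); the name is mandated.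
set_option linter.dupNamespace false
set_option autoImplicit false

namespace Summit.ValiantsHypothesis.ValiantsHypothesis.Theorems.KPlusLogSqLaw
namespace StaticTridiagonalRealUnit

open Real Finset Polynomial
open Summit.ValiantsHypothesis.ValiantsHypothesis.Theorems.KPlusLogSqLaw.StaticTridiagonalRealPotential (pathDet)

variable (d : ℕ → ℕ) (f : ℕ → ℕ)

/-! ### 1. The reflected design -/

/-- `y^c · (1/y)^e = y^{c−e}` for `e ≤ c`. [bookkeeping] -/
theorem pow_mul_one_div_pow {y : ℝ} (hy : y ≠ 0) {c e : ℕ} (he : e ≤ c) : y ^ c * (1 / y) ^ e = y ^ (c - e) := by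
  rw [one_div, inv_pow, pow_sub₀ _ hy he]

/-- **reflection identity**: for the reflected design `d' = c − d`, `f' = c − f` (`d_i, f_k ≤ c` below the size),
`y^{kc}·D_k(1/y) = D'_k(y)` for every `k ≤ n` and `y ≠ 0`. [this file] -/
theorem eval_reflect (c n : ℕ) (hd : ∀ i, i < n → d i ≤ c) (hf : ∀ k, k + 1 < n → f k ≤ c) (y : ℝ) (hy : y ≠ 0) :
    ∀ k, k ≤ n → y ^ (k * c) * (pathDet (fun _ => (1 : ℝ)) d (fun _ => (1 : ℝ)) f k).eval (1 / y) =
      (pathDet (fun _ => (1 : ℝ)) (fun i => c - d i) (fun _ => (1 : ℝ)) (fun k => c - f k) k).eval y := by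
  intro k
  induction k using Nat.strong_induction_on with
  | _ k ih =>
    intro hk
    rcases k with _ | k
    · rw [(eval_unit_zero_one d f (1 / y)).1, (eval_unit_zero_one (fun i => c - d i) (fun k => c - f k) y).1]; simp
    rcases k with _ | k
    · rw [(eval_unit_zero_one d f (1 / y)).2, (eval_unit_zero_one (fun i => c - d i) (fun k => c - f k) y).2,
        show (0 + 1) * c = c by ring]
      exact pow_mul_one_div_pow hy (hd 0 (by omega))
    · rw [eval_unit_add_two d f (1 / y) k, eval_unit_add_two (fun i => c - d i) (fun k => c - f k) y k,
        ← ih (k + 1) (by omega) (by omega), ← ih k (by omega) (by omega)]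
      have h1 : y ^ ((k + 2) * c) * (1 / y) ^ d (k + 1) = y ^ (c - d (k + 1)) * y ^ ((k + 1) * c) := by
        rw [show (k + 2) * c = (k + 1) * c + c by ring, pow_add, mul_assoc, pow_mul_one_div_pow hy (hd (k + 1) (by omega))]
        ring
      have h2 : y ^ ((k + 2) * c) * (1 / y) ^ (2 * f k) = y ^ (2 * (c - f k)) * y ^ (k * c) := by
        have hfk := hf k (by omega)
        rw [show (k + 2) * c = k * c + 2 * c by ring, pow_add, mul_assoc, show 2 * (c - f k) = 2 * c - 2 * f k by omega,
          pow_mul_one_div_pow hy (by omega)]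
        ring
      rw [mul_sub, ← mul_assoc, ← mul_assoc, h1, h2]
      ring

/-! ### 2. The mirror law above the resonance -/

/-- **THE DOMINANT-MIRROR COUNT LAW (`3 ≤ m ≤ 8`, all exponents)**: all edge slopes NEGATIVE (`2f_k < d_k + d_{k+1}`, so `(1, ∞)` is the recessive
side) and every zero of `D_m` in `(1, ∞)` non-degenerate ⇒ the DISTINCT zeros of `D_m` in `(1, ∞)` number exactly `⌊m/3⌋`
(the reflected design `c − d`, `c − f` has positive slopes and its zeros in `(0,1)` are the inverses). [this file] -/
theorem card_posRoots_above_one_eq_div_three (m : ℕ) (hm : 3 ≤ m) (hm8 : m ≤ 8)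
    (hslope : ∀ k, k + 1 < m → 2 * f k < d k + d (k + 1))
    (hnd : ∀ t, 1 < t → (pathDet (fun _ => (1 : ℝ)) d (fun _ => (1 : ℝ)) f m).eval t = 0 →
      ∀ k, 0 < k → k < m → (pathDet (fun _ => (1 : ℝ)) d (fun _ => (1 : ℝ)) f k).eval t ≠ 0) :
    (((pathDet (fun _ => (1 : ℝ)) d (fun _ => (1 : ℝ)) f m).roots.toFinset).filter (fun t => 1 < t)).card = m / 3 := by
  classical
  -- the reflection level `c`
  set c : ℕ := ∑ i ∈ range m, d i + ∑ k ∈ range m, f k with hc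
  have hdc : ∀ i, i < m → d i ≤ c := fun i hi =>
    (Finset.single_le_sum (fun j _ => Nat.zero_le (d j)) (mem_range.2 hi)).trans (Nat.le_add_right _ _)
  have hfc : ∀ k, k + 1 < m → f k ≤ c := fun k hk =>
    (Finset.single_le_sum (fun j _ => Nat.zero_le (f j)) (mem_range.2 (by omega : k < m))).trans (Nat.le_add_left _ _)
  set d' : ℕ → ℕ := fun i => c - d i with hd'
  set f' : ℕ → ℕ := fun k => c - f k with hf'
  have hslope' : ∀ k, k + 1 < m → d' k + d' (k + 1) < 2 * f' k := by
    intro k hk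
    have h1 := hdc k (by omega); have h2 := hdc (k + 1) hk; have h3 := hfc k hk; have h4 := hslope k hk
    simp only [hd', hf']; omega
  have hrefl : ∀ y : ℝ, y ≠ 0 → ∀ k, k ≤ m → y ^ (k * c) * (pathDet (fun _ => (1 : ℝ)) d (fun _ => (1 : ℝ)) f k).eval (1 / y) =
      (pathDet (fun _ => (1 : ℝ)) d' (fun _ => (1 : ℝ)) f' k).eval y := fun y hy => eval_reflect d f c m hdc hfc y hy
  -- non-degeneracy of the reflected design on `(0,1)`
  have hnd' : ∀ t, 0 < t → t < 1 → (pathDet (fun _ => (1 : ℝ)) d' (fun _ => (1 : ℝ)) f' m).eval t = 0 →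
      ∀ k, 0 < k → k < m → (pathDet (fun _ => (1 : ℝ)) d' (fun _ => (1 : ℝ)) f' k).eval t ≠ 0 := by
    intro t ht ht1 hroot k hk0 hkm
    have htm := hrefl t ht.ne' m le_rfl
    rw [hroot] at htm
    have hDm : (pathDet (fun _ => (1 : ℝ)) d (fun _ => (1 : ℝ)) f m).eval (1 / t) = 0 := by
      rcases mul_eq_zero.1 htm with h | h
      · exact absurd h (pow_ne_zero _ ht.ne')
      · exact h
    have hk := hnd (1 / t) (by rw [lt_div_iff₀ ht]; linarith) hDm k hk0 hkm
    rw [← hrefl t ht.ne' k hkm.le]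
    exact mul_ne_zero (pow_ne_zero _ ht.ne') hk
  have hcount := card_posRoots_unit_interval_eq_div_three d' f' m hm hm8 hslope' hnd'
  -- the two polynomials are non-zero
  have hpos' : 0 < (pathDet (fun _ => (1 : ℝ)) d' (fun _ => (1 : ℝ)) f' m).eval (1 / 4) := by
    obtain ⟨n, rfl⟩ : ∃ n, m = n + 1 := ⟨m - 1, by omega⟩
    exact (continuant_pos_of_le_quarter d' f' (n + 1) (1 / 4) (by norm_num) le_rfl hslope' n (by omega)).1
  have hP' : pathDet (fun _ => (1 : ℝ)) d' (fun _ => (1 : ℝ)) f' m ≠ 0 := by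
    intro h0; rw [h0, eval_zero] at hpos'; exact lt_irrefl _ hpos'
  have hP : pathDet (fun _ => (1 : ℝ)) d (fun _ => (1 : ℝ)) f m ≠ 0 := by
    intro h0
    have := hrefl (1 / 4) (by norm_num) m le_rfl
    rw [h0, eval_zero, mul_zero] at this
    rw [← this] at hpos'
    exact lt_irrefl _ hpos'
  -- the bijection `t ↦ 1/t`
  rw [← hcount]
  refine Finset.card_nbij (fun t => 1 / t) (fun t ht => ?_) (fun t₁ ht₁ t₂ ht₂ h => ?_) (fun s hs => ?_)
  · rw [Finset.mem_coe, Finset.mem_filter, Multiset.mem_toFinset, mem_roots hP] at ht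
    obtain ⟨hroot, ht1⟩ := ht
    have ht0 : 0 < t := by linarith
    rw [Finset.mem_coe, Finset.mem_filter, Multiset.mem_toFinset, mem_roots hP', IsRoot.def]
    refine ⟨?_, by positivity, by rw [div_lt_one ht0]; exact ht1⟩
    rw [← hrefl (1 / t) (by positivity) m le_rfl, one_div_one_div, IsRoot.def.1 hroot, mul_zero]
  · have h' : (1 : ℝ) / t₁ = 1 / t₂ := h
    rwa [one_div, one_div, _root_.inv_inj] at h'
  · rw [Finset.mem_coe, Finset.mem_filter, Multiset.mem_toFinset, mem_roots hP'] at hs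
    obtain ⟨hroot, hs0, hs1⟩ := hs
    refine ⟨1 / s, ?_, by show 1 / (1 / s) = s; rw [one_div_one_div]⟩
    rw [Finset.mem_coe, Finset.mem_filter, Multiset.mem_toFinset, mem_roots hP, IsRoot.def]
    refine ⟨?_, by rw [lt_div_iff₀ hs0]; linarith⟩
    have := hrefl s hs0.ne' m le_rfl
    rw [IsRoot.def.1 hroot] at this
    rcases mul_eq_zero.1 this with h | h
    · exact absurd h (pow_ne_zero _ hs0.ne')
    · exact h

end StaticTridiagonalRealUnit
end Summit.ValiantsHypothesis.ValiantsHypothesis.Theorems.KPlusLogSqLaw
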